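import Literature.Topology.FourManifolds.HeightDictionary
import Literature.Topology.FourManifolds.HeightTwoCriticalBall
import Literature.Topology.FourManifolds.MorseProofs
import Mathlib.Topology.Homeomorph.Lemmas
import HarnessLib

/-!
# Transport of the Morse data of an embedded sphere along the normalising moves

Topic `Literature/Topology/FourManifolds`; fact seat of Alexander's theorem
(`provefact-Literature.Topology.FourManifolds.SphereEmbedding.schoenflies_exists_ball`, Schultens
(2014), Thm. 3.2.5).  **Everything in this file is proved; no definitions, no named facts.**

The induction of Schultens' proof (PDF pp. 44–45) tracks the saddles of the height function on
the sphere and the components of its level `0`.  The normalising moves of the step are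
diffeomorphisms of `ℝ³` which are the identity, together with the defining function, off a closed
"modification zone" free of horizontal points (`CircleNormalForm.exists_tubeNormalForm`); this
file shows that such a move leaves the critical points of the height, their germs (hence
Morse-ness and indices) and their values untouched, and that a homeomorphism does not change
the number of components of a set:

* `SphereMoves.zoneMove_transport` — the Morse data of `Φ ∘ f` equal those of `f`.
* `SphereMoves.ncard_components_image` — `#components(Ψ(A)) = #components(A)`.

## References
* J. Schultens, *Introduction to 3-Manifolds*, GSM 151, AMS (2014), proof of Thm. 3.2.5 (PDF
  pp. 44–45).
-/

noncomputable section

open Set Metric Filter Topology Function Module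
open scoped ContDiff RealInnerProductSpace Manifold

namespace Literature.Topology.FourManifolds.SphereMoves

/-- **The number of connected components of a set is invariant under homeomorphisms.**
[folklore] -/
theorem ncard_components_image {X Y : Type*} [TopologicalSpace X] [TopologicalSpace Y] (Ψ : X ≃ₜ Y) (A : Set X) :
    {C | ∃ x ∈ Ψ '' A, C = connectedComponentIn (Ψ '' A) x}.ncard = {C | ∃ x ∈ A, C = connectedComponentIn A x}.ncard := by
  have heq : {C | ∃ x ∈ Ψ '' A, C = connectedComponentIn (Ψ '' A) x} =
      (fun C => Ψ '' C) '' {C | ∃ x ∈ A, C = connectedComponentIn A x} := by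
    ext C
    simp only [mem_setOf_eq, mem_image]
    constructor
    · rintro ⟨_, ⟨x, hx, rfl⟩, rfl⟩
      exact ⟨connectedComponentIn A x, ⟨x, hx, rfl⟩, Ψ.image_connectedComponentIn hx⟩
    · rintro ⟨C', ⟨x, hx, rfl⟩, rfl⟩
      exact ⟨Ψ x, ⟨x, hx, rfl⟩, Ψ.image_connectedComponentIn hx⟩
  rw [heq, Set.ncard_image_of_injective _ (Set.image_injective.2 Ψ.injective)]

/-- **A move supported in a zone free of horizontal points does not change the Morse data.**
Let `f : 𝕊² → ℝ³` be a smooth embedding into `{F = 0}` (`F` smooth, regular on its zero set)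
with Morse height, `Φ` a diffeomorphism with `Φ({F = 0}) = {G = 0}` (`G` smooth, regular on its
zero set), and `M` a closed set off which `Φ = id` and `G = F`, such that neither `F` nor `G`
has a horizontal zero in `M`.  Then `f' = Φ ∘ f` is a smooth embedding into `{G = 0}` with Morse
height, the same critical points as `f` — at which `f' = f` — and the same saddles.
[cite: Schultens2014, proof of Thm. 3.2.5 (PDF pp. 44–45)] -/
theorem zoneMove_transport
    {f : sphere (0 : EuclideanSpace ℝ (Fin 3)) 1 → EuclideanSpace ℝ (Fin 3)}
    (hf : Manifold.IsSmoothEmbedding (𝓡 2) 𝓘(ℝ, EuclideanSpace ℝ (Fin 3)) ∞ f)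
    {F G : EuclideanSpace ℝ (Fin 3) → ℝ} (hF : ContDiff ℝ ∞ F) (hG : ContDiff ℝ ∞ G)
    (hfF : ∀ y, F (f y) = 0) (hregF : ∀ x, F x = 0 → fderiv ℝ F x ≠ 0) (hregG : ∀ x, G x = 0 → fderiv ℝ G x ≠ 0)
    (Φ : EuclideanSpace ℝ (Fin 3) ≃ₘ⟮𝓘(ℝ, EuclideanSpace ℝ (Fin 3)), 𝓘(ℝ, EuclideanSpace ℝ (Fin 3))⟯ EuclideanSpace ℝ (Fin 3))
    (himg : Φ '' {x | F x = 0} = {x | G x = 0})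
    {M : Set (EuclideanSpace ℝ (Fin 3))} (hM : IsClosed M) (hΦid : ∀ x, x ∉ M → Φ x = x) (hGF : ∀ x, x ∉ M → G x = F x)
    (hFh : ∀ x ∈ M, F x = 0 → ∀ c : ℝ, fderiv ℝ F x ≠ c • innerSL ℝ (EuclideanSpace.single (2 : Fin 3) (1 : ℝ)))
    (hGh : ∀ x ∈ M, G x = 0 → ∀ c : ℝ, fderiv ℝ G x ≠ c • innerSL ℝ (EuclideanSpace.single (2 : Fin 3) (1 : ℝ)))
    (hMorse : IsMorse (𝓡 2) (fun y => ⟪EuclideanSpace.single (2 : Fin 3) (1 : ℝ), f y⟫)) :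
    Manifold.IsSmoothEmbedding (𝓡 2) 𝓘(ℝ, EuclideanSpace ℝ (Fin 3)) ∞ (fun y => Φ (f y)) ∧
    (∀ y, G (Φ (f y)) = 0) ∧
    IsMorse (𝓡 2) (fun y => ⟪EuclideanSpace.single (2 : Fin 3) (1 : ℝ), Φ (f y)⟫) ∧
    (∀ y, IsMCriticalPt (𝓡 2) (fun y => ⟪EuclideanSpace.single (2 : Fin 3) (1 : ℝ), Φ (f y)⟫) y ↔
      IsMCriticalPt (𝓡 2) (fun y => ⟪EuclideanSpace.single (2 : Fin 3) (1 : ℝ), f y⟫) y) ∧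
    (∀ y, IsMCriticalPt (𝓡 2) (fun y => ⟪EuclideanSpace.single (2 : Fin 3) (1 : ℝ), f y⟫) y → Φ (f y) = f y) ∧
    criticalSetOfIndex (𝓡 2) (fun y => ⟪EuclideanSpace.single (2 : Fin 3) (1 : ℝ), Φ (f y)⟫) 1 =
      criticalSetOfIndex (𝓡 2) (fun y => ⟪EuclideanSpace.single (2 : Fin 3) (1 : ℝ), f y⟫) 1 := by
  set v : EuclideanSpace ℝ (Fin 3) := EuclideanSpace.single (2 : Fin 3) (1 : ℝ) with hv
  have hv0 : v ≠ 0 := by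
    intro h; have := congrArg (fun w : EuclideanSpace ℝ (Fin 3) => w 2) h; simp [hv] at this
  have hdim : finrank ℝ (EuclideanSpace ℝ (Fin 3)) = 2 + 1 := by simp
  have hdim3 : finrank ℝ (EuclideanSpace ℝ (Fin 3)) = 3 := by simp
  set f' : sphere (0 : EuclideanSpace ℝ (Fin 3)) 1 → EuclideanSpace ℝ (Fin 3) := fun y => Φ (f y) with hf'
  have hf'e : Manifold.IsSmoothEmbedding (𝓡 2) 𝓘(ℝ, EuclideanSpace ℝ (Fin 3)) ∞ f' := hf.diffeomorph_comp Φ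
  have hf'G : ∀ y, G (f' y) = 0 := fun y => by
    have : Φ (f y) ∈ Φ '' {x | F x = 0} := ⟨f y, hfF y, rfl⟩
    rw [himg] at this; exact this
  have hinjf : ∀ x, Injective (mfderiv (𝓡 2) 𝓘(ℝ, EuclideanSpace ℝ (Fin 3)) f x) := fun x =>
    injective_mfderiv_of_isImmersionAt' (hf.isImmersion.isImmersionAt x)
  have hinjf' : ∀ x, Injective (mfderiv (𝓡 2) 𝓘(ℝ, EuclideanSpace ℝ (Fin 3)) f' x) := fun x =>
    injective_mfderiv_of_isImmersionAt' (hf'e.isImmersion.isImmersionAt x)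
  have hF2 : ContDiff ℝ 2 F := hF.of_le (by norm_cast)
  have hG2 : ContDiff ℝ 2 G := hG.of_le (by norm_cast)
  have hregFf : ∀ y, fderiv ℝ F (f y) ≠ 0 := fun y => hregF _ (hfF y)
  have hregGf : ∀ y, fderiv ℝ G (f' y) ≠ 0 := fun y => hregG _ (hf'G y)
  -- off the closed zone `G = F` as germs and `Φ = id`
  have hgerm : ∀ p, p ∉ M → G =ᶠ[𝓝 p] F := fun p hp => by
    filter_upwards [hM.isOpen_compl.mem_nhds hp] with x hx using hGF x hx
  -- horizontal zeros of `F` on the sphere are off the zone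
  have hoffF : ∀ y (c : ℝ), fderiv ℝ F (f y) = c • innerSL ℝ v → f y ∉ M := fun y c hc hmem =>
    hFh _ hmem (hfF y) c hc
  have hoffG : ∀ y (c : ℝ), fderiv ℝ G (f' y) = c • innerSL ℝ v → f' y ∉ M := fun y c hc hmem =>
    hGh _ hmem (hf'G y) c hc
  -- at such points `f' = f` and the derivatives of `G` and `F` agree
  have hkeyF : ∀ y (c : ℝ), fderiv ℝ F (f y) = c • innerSL ℝ v →
      f' y = f y ∧ fderiv ℝ G (f y) = fderiv ℝ F (f y) ∧ fderiv ℝ (fderiv ℝ G) (f y) = fderiv ℝ (fderiv ℝ F) (f y) := by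
    intro y c hc
    have hp := hoffF y c hc
    exact ⟨hΦid _ hp, (hgerm _ hp).fderiv_eq, (hgerm _ hp).fderiv.fderiv_eq⟩
  have hkeyG : ∀ y (c : ℝ), fderiv ℝ G (f' y) = c • innerSL ℝ v →
      f' y = f y ∧ fderiv ℝ G (f y) = fderiv ℝ F (f y) ∧ fderiv ℝ (fderiv ℝ G) (f y) = fderiv ℝ (fderiv ℝ F) (f y) := by
    intro y c hc
    have hp := hoffG y c hc
    have hfix : f' y = f y := Φ.injective (hΦid _ hp)
    rw [hfix] at hp
    exact ⟨hfix, (hgerm _ hp).fderiv_eq, (hgerm _ hp).fderiv.fderiv_eq⟩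
  -- the nondegeneracy conditions
  have hsepF := (HeightDictionary.isMorse_inner_comp_iff hdim hf.contMDiff hinjf hF2 hfF hregFf hv0).1 hMorse
  have hsepG : ∀ x (c : ℝ), fderiv ℝ G (f' x) = c • innerSL ℝ v →
      ∀ w, ⟪v, w⟫ = 0 → (∀ w', ⟪v, w'⟫ = 0 → fderiv ℝ (fderiv ℝ G) (f' x) w w' = 0) → w = 0 := by
    intro y c hc w hw hker
    obtain ⟨hfix, hD1, hD2⟩ := hkeyG y c hc
    rw [hfix] at hc hker
    rw [hD1] at hc
    rw [hD2] at hker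
    exact hsepF y c hc w hw hker
  have hMorse' : IsMorse (𝓡 2) (fun y => ⟪v, f' y⟫) :=
    (HeightDictionary.isMorse_inner_comp_iff hdim hf'e.contMDiff hinjf' hG2 hf'G hregGf hv0).2 hsepG
  -- critical points
  have hcritF : ∀ y, IsMCriticalPt (𝓡 2) (fun y => ⟪v, f y⟫) y ↔ ∃ c : ℝ, fderiv ℝ F (f y) = c • innerSL ℝ v := fun y =>
    ExpHeight.isMCriticalPt_inner_comp_iff hdim ((hf.contMDiff y).mdifferentiableAt (by simp)) (hinjf y)
      ((hF2.differentiable (by norm_cast)) _) hfF (hregFf y) hv0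
  have hcritG : ∀ y, IsMCriticalPt (𝓡 2) (fun y => ⟪v, f' y⟫) y ↔ ∃ c : ℝ, fderiv ℝ G (f' y) = c • innerSL ℝ v := fun y =>
    ExpHeight.isMCriticalPt_inner_comp_iff hdim ((hf'e.contMDiff y).mdifferentiableAt (by simp)) (hinjf' y)
      ((hG2.differentiable (by norm_cast)) _) hf'G (hregGf y) hv0
  have hcrit_iff : ∀ y, IsMCriticalPt (𝓡 2) (fun y => ⟪v, f' y⟫) y ↔ IsMCriticalPt (𝓡 2) (fun y => ⟪v, f y⟫) y := by
    intro y
    rw [hcritF, hcritG]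
    constructor
    · rintro ⟨c, hc⟩
      obtain ⟨hfix, hD1, -⟩ := hkeyG y c hc
      exact ⟨c, by rw [← hD1, ← hfix]; exact hc⟩
    · rintro ⟨c, hc⟩
      obtain ⟨hfix, hD1, -⟩ := hkeyF y c hc
      exact ⟨c, by rw [hfix, hD1]; exact hc⟩
  have hcrit_fix : ∀ y, IsMCriticalPt (𝓡 2) (fun y => ⟪v, f y⟫) y → f' y = f y := by
    intro y hy
    obtain ⟨c, hc⟩ := (hcritF y).1 hy
    exact (hkeyF y c hc).1
  -- saddles
  have hC₁F := HeightDictionary.criticalSetOfIndex_one_eq_preimage hdim3 hf.contMDiff hinjf hF2 hfF hregFf hv0 hsepF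
  have hC₁G := HeightDictionary.criticalSetOfIndex_one_eq_preimage hdim3 hf'e.contMDiff hinjf' hG2 hf'G hregGf hv0 hsepG
  have hC₁ : criticalSetOfIndex (𝓡 2) (fun y => ⟪v, f' y⟫) 1 = criticalSetOfIndex (𝓡 2) (fun y => ⟪v, f y⟫) 1 := by
    rw [hC₁F, hC₁G]
    ext y
    simp only [mem_preimage, mem_setOf_eq]
    constructor
    · rintro ⟨⟨c, hc⟩, hneg, hpos⟩
      obtain ⟨hfix, hD1, hD2⟩ := hkeyG y c hc
      rw [hfix, hD1] at hc; rw [hfix, hD2] at hneg hpos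
      exact ⟨⟨c, hc⟩, hneg, hpos⟩
    · rintro ⟨⟨c, hc⟩, hneg, hpos⟩
      obtain ⟨hfix, hD1, hD2⟩ := hkeyF y c hc
      rw [hfix, hD1, hD2]
      exact ⟨⟨c, hc⟩, hneg, hpos⟩
  exact ⟨hf'e, hf'G, hMorse', hcrit_iff, hcrit_fix, hC₁⟩

end Literature.Topology.FourManifolds.SphereMoves
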